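import HarnessLib
import Summits.RiemannHypothesis.RiemannHypothesis.Theorems.SignConePointwiseBounds

/-!
# Route SignCone: a sharper Lipschitz constant for `Ê_χ` (pointwise certificates)

Support for the unconditional rungs of `SignConeOscillatory` / `SignConeInequality`
(items stmt-RiemannHypothesis-16302 / 16301). The Lipschitz constant `∫ |x| |E_χ(x)| dx` of the
cosine transform `Ê_χ` governs the cell widths of the pointwise certificates. `SignConePointwiseBounds.lean`
bounds it by `x_K Ê_{|χ|}(0)`; here the plateau `[-L, L]`, where `E_χ(x) = e^{x/2} + e^{-x/2}` exactly,
is integrated in closed form: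

  `∫ |x| |E_χ(x)| dx ≤ 2 (4L sinh(L/2) − 8 cosh(L/2) + 8) + x_K (Ê_{|χ|}(0) − 8 sinh(L/2))`

(`PWKernel.integral_abs_mul_abs_kernelE_le_sharp`; about three times smaller for the certificate at `b = 1`).
-/

noncomputable section

-- `Summit.RiemannHypothesis.RiemannHypothesis.…` repeats a namespace component by design (D-0017 layout).
set_option linter.dupNamespace false

open Real MeasureTheory Set Filter intervalIntegral

namespace Summit.RiemannHypothesis.RiemannHypothesis.Theorems.SignCone

/-- `R(x) = 2x e^{x/2} − 4e^{x/2} − 2x e^{−x/2} − 4e^{−x/2}`, an antiderivative of `x (e^{x/2} + e^{−x/2})`. [folklore] -/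
def pwR (x : ℝ) : ℝ := 2 * x * Real.exp (x / 2) - 4 * Real.exp (x / 2) - 2 * x * Real.exp (-(x / 2)) - 4 * Real.exp (-(x / 2))

/-- `∂ₓ R = x (e^{x/2} + e^{-x/2})`. [folklore] -/
theorem hasDerivAt_pwR (x : ℝ) : HasDerivAt pwR (x * (Real.exp (x / 2) + Real.exp (-(x / 2)))) x := by
  have h1 : HasDerivAt (fun x : ℝ => Real.exp (x / 2)) (Real.exp (x / 2) * (1 / 2)) x :=
    ((hasDerivAt_id' x).div_const 2).exp
  have h2 : HasDerivAt (fun x : ℝ => Real.exp (-(x / 2))) (Real.exp (-(x / 2)) * (-(1 / 2))) x :=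
    (((hasDerivAt_id' x).div_const 2).neg).exp
  have hx : HasDerivAt (fun x : ℝ => 2 * x) 2 x := by simpa using (hasDerivAt_id' x).const_mul 2
  have h := (((hx.mul h1).sub (h1.const_mul 4)).sub (hx.mul h2)).sub (h2.const_mul 4)
  refine h.congr_deriv ?_
  ring

/-- `∫_a^b x (e^{x/2} + e^{-x/2}) dx = R(b) − R(a)`. [folklore] -/
theorem integral_mul_exp_add (a b : ℝ) :
    ∫ x in a..b, x * (Real.exp (x / 2) + Real.exp (-(x / 2))) = pwR b - pwR a :=
  integral_eq_sub_of_hasDerivAt (fun x _ => hasDerivAt_pwR x)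
    ((by fun_prop : Continuous fun x : ℝ => x * (Real.exp (x / 2) + Real.exp (-(x / 2)))).intervalIntegrable _ _)

/-- `∫_a^b (e^{x/2} + e^{-x/2}) dx = [2e^{x/2} − 2e^{-x/2}]_a^b`. [folklore] -/
theorem integral_exp_add (a b : ℝ) :
    ∫ x in a..b, (Real.exp (x / 2) + Real.exp (-(x / 2))) =
      (2 * Real.exp (b / 2) - 2 * Real.exp (-(b / 2))) - (2 * Real.exp (a / 2) - 2 * Real.exp (-(a / 2))) := by
  have hd : ∀ x : ℝ, HasDerivAt (fun x : ℝ => 2 * Real.exp (x / 2) - 2 * Real.exp (-(x / 2)))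
      (Real.exp (x / 2) + Real.exp (-(x / 2))) x := by
    intro x
    have h1 : HasDerivAt (fun x : ℝ => Real.exp (x / 2)) (Real.exp (x / 2) * (1 / 2)) x :=
      ((hasDerivAt_id' x).div_const 2).exp
    have h2 : HasDerivAt (fun x : ℝ => Real.exp (-(x / 2))) (Real.exp (-(x / 2)) * (-(1 / 2))) x :=
      (((hasDerivAt_id' x).div_const 2).neg).exp
    refine ((h1.const_mul 2).sub (h2.const_mul 2)).congr_deriv ?_
    ring
  exact integral_eq_sub_of_hasDerivAt (fun x _ => hd x)
    ((by fun_prop : Continuous fun x : ℝ => Real.exp (x / 2) + Real.exp (-(x / 2))).intervalIntegrable _ _)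

/-- `R(L) = 4L sinh(L/2) − 8 cosh(L/2)` and `R(0) = −8`, `R(−L) = R(L)`. [folklore] -/
theorem pwR_eq (L : ℝ) : pwR L = 4 * L * Real.sinh (L / 2) - 8 * Real.cosh (L / 2) ∧ pwR 0 = -8 ∧ pwR (-L) = pwR L := by
  refine ⟨by unfold pwR; rw [Real.sinh_eq, Real.cosh_eq]; ring, by unfold pwR; simp; ring, ?_⟩
  unfold pwR
  rw [neg_div, neg_neg]
  ring

namespace PWKernel

variable {d : PWKernel} (hL : 0 ≤ d.L) (hh : 0 < d.h)
include hL hh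

/-- **The sharp Lipschitz constant.**
`∫ |x| |E_χ(x)| dx ≤ 2 (4L sinh(L/2) − 8 cosh(L/2) + 8) + x_K (Ê_{|χ|}(0) − 8 sinh(L/2))`. [folklore] -/
theorem integral_abs_mul_abs_kernelE_le_sharp :
    ∫ x : ℝ, |x| * |d.kernelE x| ≤
      2 * (4 * d.L * Real.sinh (d.L / 2) - 8 * Real.cosh (d.L / 2) + 8) +
        (d.knot d.K : ℝ) * (d.absKernel.ehatCF 0 - 8 * Real.sinh (d.L / 2)) := by
  have hL' : (0 : ℝ) ≤ d.L := by exact_mod_cast hL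
  have hX : (0 : ℝ) ≤ d.knot d.K := knot_nonneg hL hh _
  have hLX : (d.L : ℝ) ≤ d.knot d.K := by
    have := knot_mono (d := d) hh (Nat.zero_le d.K)
    have e0 : (d.knot 0 : ℝ) = d.L := by unfold knot; push_cast; ring
    rwa [e0] at this
  -- the two indicator functions
  set p : ℝ → ℝ := Set.indicator (Icc (-(d.L : ℝ)) d.L)
    (fun x => |x| * (Real.exp (x / 2) + Real.exp (-(x / 2)))) with hp
  set q : ℝ → ℝ := Set.indicator (Icc (-(d.L : ℝ)) d.L)
    (fun x => Real.exp (x / 2) + Real.exp (-(x / 2))) with hq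
  have hEp : ∀ x : ℝ, 0 ≤ d.absKernel.kernelE x := fun x =>
    (abs_nonneg _).trans (abs_kernelE_le_absKernel hh x)
  -- pointwise domination
  have hpt : ∀ x : ℝ, |x| * |d.kernelE x| ≤ p x + (d.knot d.K : ℝ) * (d.absKernel.kernelE x - q x) := by
    intro x
    by_cases hxL : |x| ≤ d.L
    · have hmem : x ∈ Icc (-(d.L : ℝ)) d.L := abs_le.1 hxL
      have hE : d.kernelE x = Real.exp (x / 2) + Real.exp (-(x / 2)) := kernelE_eq_of_abs_le hh hxL
      have hE' : d.absKernel.kernelE x = Real.exp (x / 2) + Real.exp (-(x / 2)) :=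
        kernelE_eq_of_abs_le (d := d.absKernel) hh hxL
      rw [hp, hq, Set.indicator_of_mem hmem, Set.indicator_of_mem hmem, hE, hE', sub_self, mul_zero, add_zero,
        abs_of_pos (by positivity : (0 : ℝ) < Real.exp (x / 2) + Real.exp (-(x / 2)))]
    · have hmem : x ∉ Icc (-(d.L : ℝ)) d.L := fun h' => hxL (abs_le.2 h')
      rw [hp, hq, Set.indicator_of_notMem hmem, Set.indicator_of_notMem hmem, zero_add, sub_zero]
      rcases le_or_gt (d.knot d.K : ℝ) |x| with h1 | h1
      · rw [kernelE_eq_zero_of_le_abs hh h1, abs_zero, mul_zero]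
        exact mul_nonneg hX (hEp x)
      · exact mul_le_mul h1.le (abs_kernelE_le_absKernel hh x) (abs_nonneg _) hX
  -- integrability
  have hcont : Continuous fun x : ℝ => Real.exp (x / 2) + Real.exp (-(x / 2)) := by fun_prop
  have hcont2 : Continuous fun x : ℝ => |x| * (Real.exp (x / 2) + Real.exp (-(x / 2))) := by fun_prop
  have ip : Integrable p :=
    (integrable_indicator_iff measurableSet_Icc).2 hcont2.continuousOn.integrableOn_Icc
  have iq : Integrable q :=
    (integrable_indicator_iff measurableSet_Icc).2 hcont.continuousOn.integrableOn_Icc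
  have iEp : Integrable d.absKernel.kernelE :=
    (continuous_kernelE _).integrable_of_hasCompactSupport (hasCompactSupport_kernelE (d := d.absKernel) hh)
  have i1 : Integrable fun x : ℝ => |x| * |d.kernelE x| :=
    ((continuous_abs.mul (continuous_abs.comp (continuous_kernelE d))).integrable_of_hasCompactSupport
      ((hasCompactSupport_kernelE hh).norm.mul_left))
  have isub : Integrable fun x : ℝ => d.absKernel.kernelE x - q x := iEp.sub iq
  have i2 : Integrable fun x : ℝ => p x + (d.knot d.K : ℝ) * (d.absKernel.kernelE x - q x) :=
    ip.add (isub.const_mul _)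
  -- the closed forms
  have hIp : ∫ x, p x = 2 * (4 * d.L * Real.sinh (d.L / 2) - 8 * Real.cosh (d.L / 2) + 8) := by
    rw [hp, MeasureTheory.integral_indicator measurableSet_Icc, integral_Icc_eq_integral_Ioc,
      ← intervalIntegral.integral_of_le (by linarith : -(d.L : ℝ) ≤ d.L),
      ← integral_add_adjacent_intervals (b := 0) (hcont2.intervalIntegrable _ _) (hcont2.intervalIntegrable _ _)]
    have hneg : ∫ x in (-(d.L : ℝ))..0, |x| * (Real.exp (x / 2) + Real.exp (-(x / 2))) = -(pwR 0 - pwR (-d.L)) := by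
      rw [← integral_mul_exp_add, ← intervalIntegral.integral_neg]
      refine integral_congr fun x hx => ?_
      rw [uIcc_of_le (by linarith)] at hx
      rw [abs_of_nonpos hx.2]; ring
    have hpos : ∫ x in (0 : ℝ)..d.L, |x| * (Real.exp (x / 2) + Real.exp (-(x / 2))) = pwR d.L - pwR 0 := by
      rw [← integral_mul_exp_add]
      refine integral_congr fun x hx => ?_
      rw [uIcc_of_le hL'] at hx
      rw [abs_of_nonneg hx.1]
    rw [hneg, hpos]
    obtain ⟨e1, e2, e3⟩ := pwR_eq (d.L : ℝ)
    rw [e3, e1, e2]; ring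
  have hIq : ∫ x, q x = 8 * Real.sinh (d.L / 2) := by
    rw [hq, MeasureTheory.integral_indicator measurableSet_Icc, integral_Icc_eq_integral_Ioc,
      ← intervalIntegral.integral_of_le (by linarith : -(d.L : ℝ) ≤ d.L), integral_exp_add]
    rw [Real.sinh_eq, neg_div, neg_neg]; ring
  have hIE : ∫ x, d.absKernel.kernelE x = d.absKernel.ehatCF 0 := by
    rw [← cosTransform_kernelE_eq (d := d.absKernel) hL hh]
    unfold cosTransform; simp
  calc ∫ x : ℝ, |x| * |d.kernelE x| ≤ ∫ x : ℝ, (p x + (d.knot d.K : ℝ) * (d.absKernel.kernelE x - q x)) :=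
        integral_mono i1 i2 hpt
    _ = (∫ x, p x) + (d.knot d.K : ℝ) * ((∫ x, d.absKernel.kernelE x) - ∫ x, q x) := by
        rw [integral_add ip (isub.const_mul _), MeasureTheory.integral_const_mul, integral_sub iEp iq]
    _ = _ := by rw [hIp, hIq, hIE]

end PWKernel

end Summit.RiemannHypothesis.RiemannHypothesis.Theorems.SignCone

end
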